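import Summits.BirchSwinnertonDyer.BirchSwinnertonDyer.Theses.UniversalToricDescent
import Summits.BirchSwinnertonDyer.BirchSwinnertonDyer.Theorems.UniversalToricDescentToricTransportModThreeStubRatSqueeze
import Summits.BirchSwinnertonDyer.BirchSwinnertonDyer.Theorems.UniversalToricDescentAcDualMuZeroCriterion
import Mathlib.RingTheory.Polynomial.Cyclotomic.Basic
import HarnessLib

/-!
# NODE `toothwise_kolyvagin_mu` — crux `AdditiveSplitIMCInclusionAtThree` (stmt-BirchSwinnertonDyer-20395, THE WALL, UTD r201)
# crux-ideate round 3 (unit cruxidea-stmt-BirchSwinnertonDyer-20395-1-g3), 2026-08-30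

D-0171 NODE for the crux idea `toothwise-kolyvagin-mu` (card `Ideas/toothwise-kolyvagin-mu.md`, line card
`Lines/toothwise_kolyvagin_mu.md`). Two levels, both kernel-checked compositions, `sorry` only inside `stub_*`:

* TOP (`AdditiveSplitIMCInclusionAtThree_of`): WALL ⟸ RATWALL (route item 24207 `RationalSplitIMCInclusionAtThree`,
  BY NAME — tag WEAKER) + `SelfAlgMuZeroAtThree` (the curve's OWN algebraic `μ = 0` for `X_(∅,0)(E/K_∞)` strict at
  `𝔭′`, in the route's `R₀⟦T⟧` currency = the conclusion shape of the twin item 24737 transported to `E` — tag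
  UNDECIDED, EQUIV-type node ⇒ it has a child). Proof = 3-saturation in the domain `R₀⟦T⟧` with the LANDED lemmas
  `RatwallThinComb.dvd_of_dvd_prime_pow_mul`, `prime_C_three`, `not_C_three_dvd_of_norm_coeff_eq_one` (p703763).
* CHILD (`selfAlgMuZeroAtThree_of_teeth`): `SelfAlgMuZeroAtThree` ⟸ three pieces — (c1) `IsTorsionOfFiniteToothQuot`
  (pure `Λ`-algebra, ATTACKABLE), (c2) `ToothReadsMu` (pure `Λ`-algebra: `μ(M) = 0` iff the specialisations of `M`
  at the CYCLOTOMIC TEETH `𝔮_k = (Φ_{3^k}(1+T))` stay below `3^{φ(3^k)/2}` infinitely often; ATTACKABLE, sibling of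
  the tree's `exists_card_quotSMulTop_qm_bounds` at Howard's primes `T^m + p`), (c3) `ToothCardSmallAtThree` (the
  ARITHMETIC LEAF: at infinitely many teeth the `(∅,0)` Selmer specialisation `X ⧸ 𝔮_k X` is finite of order
  `< 3^{φ(3^k)/2}` — UNDECIDED; informal engine = tooth-supported Kolyvagin systems from the trace-zero CM classes,
  see the line card) — plus the LANDED `AcSelmer.XAc.module_finite` and
  `UniversalToricDescentAcDualMuZero.exists_map_charIdeal_eq_span_of_muInvariant_eq_zero` BY NAME.

Nothing here is a theorem about elliptic curves beyond the compositions; BSD is not advanced by this file.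
References: [Howard2004HeegnerKolyvagin] §1.6, proof of Thm. 2.2.10; [MazurRubin2004] §§4.4–5.2;
[GreenbergVatsal2000] §2; [Washington1997] §7.1, §13.2; Bertolini, Compositio 99 (1995); [CornutVatsal2005].
-/

set_option linter.dupNamespace false
set_option autoImplicit false

noncomputable section

open Literature.NumberTheory.EllipticCurves
open Summit.BirchSwinnertonDyer.BirchSwinnertonDyer.Theses.UniversalToricDescent
  (RationalSplitIMCInclusionAtThree AdditiveSplitIMCInclusionAtThree)
open Summit.BirchSwinnertonDyer.BirchSwinnertonDyer.Cruxes.ToricTransportModThree.RatwallThinComb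
  (dvd_of_dvd_prime_pow_mul prime_C_three not_C_three_dvd_of_norm_coeff_eq_one)
open Summit.BirchSwinnertonDyer.Rank1Residual.X11b

namespace Summit.BirchSwinnertonDyer.BirchSwinnertonDyer.Cruxes.AdditiveSplitIMCInclusionAtThree.ToothwiseKolyvaginMu

/-! ## The cyclotomic teeth of `Λ = ℤ₃⟦T⟧` -/

/-- The `k`-th CYCLOTOMIC TOOTH `𝔮_k = Φ_{3^k}(1+T) ∈ Λ = ℤ₃⟦T⟧` (a distinguished polynomial of degree `φ(3^k)`;
`Λ/𝔮_k ≅ ℤ₃[ζ_{3^k}] =: O_k`, the ring where a TRACE-ZERO layer-`k` class lives: `Tr_{K_k/K_{k-1}} y_k = 0` iff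
`Φ_{3^k}(γ)·y_k = 0`). `tooth 0 = T`. [folklore; Washington1997 §7.1] -/
def tooth (k : ℕ) : IwasawaAlgebra 3 :=
  (((Polynomial.cyclotomic (3 ^ k) ℤ_[3]).comp (Polynomial.X + 1) : Polynomial ℤ_[3]) : PowerSeries ℤ_[3])

/-- The specialisation `M ⧸ 𝔮_k M` of a `Λ`-module at the `k`-th tooth. [folklore] -/
abbrev ToothQuot (M : Type) [AddCommGroup M] [Module (IwasawaAlgebra 3) M] (k : ℕ) : Type :=
  M ⧸ (Ideal.span {tooth k} • (⊤ : Submodule (IwasawaAlgebra 3) M))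

/-! ## Pieces (Props) -/

/-- PIECE B (UNDECIDED; EQUIV-type w.r.t. the kernel road: it is the `E`-side output of the twin transport
24737 → GV 2.8; here it gets its OWN child by teeth). The curve's own algebraic `μ = 0` at additive split 3, in
the route's `R₀⟦T⟧` currency (24737's conclusion shape, binders = the wall's up to `𝔭′ ≠ 𝔭`): `X_(∅,0)(E/K_∞)`
strict at `𝔭′` is `Λ`-torsion and `Ch_Λ(X)·R₀⟦T⟧ = (g′)` with a coefficient of `3`-adic norm `1`. -/
def SelfAlgMuZeroAtThree : Prop :=
  ∀ (W : WeierstrassCurve ℚ) [W.IsElliptic] [W.IsGloballyMinimal] (N : ℕ) [NeZero N] (K : Type) [Field K]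
    [NumberField K] (Dt : Literature.NumberTheory.EllipticCurves.ModularForms.ModularParametrizationData W N),
    Summit.BirchSwinnertonDyer.Rank1Residual.Additive.ClassO6 W 3 → W.HasSurjectiveModNGaloisRep 3 →
    W.analyticRank = 1 → W.conductorNorm ℤ = N → Literature.NumberTheory.EllipticCurves.IsImaginaryQuadratic K →
    Literature.NumberTheory.EllipticCurves.SatisfiesHeegnerHypothesis N K →
    ∀ (κ : Literature.NumberTheory.EllipticCurves.ZpExtension K 3), κ.IsAnticyclotomic →
    ∀ (γ : Field.absoluteGaloisGroup K) [Fact (κ.IsTopGenerator γ)]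
      (𝔭 : IsDedekindDomain.HeightOneSpectrum (NumberField.RingOfIntegers K)),
      ((3 : ℕ) : NumberField.RingOfIntegers K) ∈ 𝔭.asIdeal →
      𝔭.asIdeal.ramificationIdx (NumberField.RingOfIntegers ℚ) = 1 →
      𝔭.asIdeal.inertiaDeg (NumberField.RingOfIntegers ℚ) = 1 →
    ∀ (𝔭' : IsDedekindDomain.HeightOneSpectrum (NumberField.RingOfIntegers K)),
      ((3 : ℕ) : NumberField.RingOfIntegers K) ∈ 𝔭'.asIdeal → 𝔭' ≠ 𝔭 →
    Module.IsTorsion (IwasawaAlgebra 3) (AcSelmer.XAc (W.baseChange K) 3 κ 𝔭' ∅ γ) ∧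
      ∃ g' : UnrSeries 3,
        (AcSelmer.XAc.charIdeal (W.baseChange K) 3 κ 𝔭' ∅ γ).map (PowerSeries.map (Halves.toUnr 3)) =
            Ideal.span {g'} ∧
          ∃ i : ℕ, ‖((PowerSeries.coeff i g' : unrIntegers 3) : ℂ_[3])‖ = 1

/-- PIECE c1 (ATTACKABLE, pure `Λ`-algebra, S-sized): a finitely generated `Λ`-module with ONE finite tooth
specialisation is `Λ`-torsion (if `m ∈ M` had annihilator `0`, then `(Λm ⊗ Λ/𝔮_k) ⊆`-controls an infinite
`O_k = Λ/𝔮_k` inside `M/𝔮_k M` after localising at the height-one prime `𝔮_k`, where finite modules die).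
[folklore; Washington1997 §13.2] -/
def IsTorsionOfFiniteToothQuot : Prop :=
  ∀ (M : Type) [AddCommGroup M] [Module (IwasawaAlgebra 3) M] [Module.Finite (IwasawaAlgebra 3) M],
    (∃ k : ℕ, Finite (ToothQuot M k)) → Module.IsTorsion (IwasawaAlgebra 3) M

/-- PIECE c2 (ATTACKABLE, pure `Λ`-algebra, M-sized): THE TEETH READ `μ`. For a finitely generated torsion
`Λ`-module `M`, `#(M ⧸ 𝔮_k M) = 3^{μ(M)·φ(3^k) + λ(M)}` up to a factor bounded in `k` (structure theorem up to
pseudo-isomorphism; `#Λ/(3^μ, Φ_{3^k}(1+T)) = 3^{μ φ(3^k)}`; `#Λ/(f, Φ_{3^k}(1+T)) = 3^{deg f}` for distinguished `f`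
once `φ(3^k) > deg f`); hence if `#(M ⧸ 𝔮_k M)^2 ≤ 3^{φ(3^k)}` for infinitely many `k` then `μ(M) = 0`. Sibling of the
tree's `exists_card_quotSMulTop_qm_bounds` / `muInvariant_le_two_mul_of_card_quotSMulTop_qm_le` at Howard's primes
`T^m + p`. NOT a divisibility statement: teeth read `(μ, λ)` only (lineage barrier B-g37-1 / B-g33-1 respected).
[Washington1997 §7.1 Prop. 7.2, §13.2 Thm. 13.12; Howard2004HeegnerKolyvagin proof of Thm. 2.2.10] -/
def ToothReadsMu : Prop :=
  ∀ (M : Type) [AddCommGroup M] [Module (IwasawaAlgebra 3) M] [Module.Finite (IwasawaAlgebra 3) M],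
    Module.IsTorsion (IwasawaAlgebra 3) M →
    (∀ k₀ : ℕ, ∃ k : ℕ, k₀ ≤ k ∧ Finite (ToothQuot M k) ∧
        Nat.card (ToothQuot M k) ^ 2 ≤ 3 ^ Nat.totient (3 ^ k)) →
    muInvariant 3 M = 0

/-- PIECE c3 — THE ARITHMETIC LEAF (UNDECIDED): at infinitely many cyclotomic teeth the `(∅,0)` anticyclotomic
Selmer dual of the WILD curve itself has a finite specialisation of order `< 3^{φ(3^k)/2}` (tooth currency of
«`X_(∅,0)(E/K_∞)` is `Λ`-torsion with `μ = 0`»). Binders = the wall's up to `𝔭′ ≠ 𝔭`. Informal engine (line card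
§Stubs): a Kolyvagin system over the DVR `O_k = Λ/𝔮_k` built from the trace-zero CM class of conductor `3^{k+f}`
(which LIVES at the tooth `𝔮_k` because its trace to `K_{k-1}` vanishes) and its Kolyvagin derivatives at inert
primes `ℓ` with `3^M ∣ ℓ+1, a_ℓ` — no vertical norm relation, no `Λ`-adic class, no admissible prime; output a
LENGTH over `O_k`; plus `μ`-strength (Vatsal/Cornut–Vatsal-type) indivisibility of that class globally and at `𝔭′`.
Why it might fail: the global/`𝔭′`-local `O_k`-divisibility index of the tooth class may grow like `c·φ(3^k)`
(`c ≥ 1/4`) at a prime of additive reduction dividing the CM conductor (Cornut–Vatsal assume `p ∤ N`). -/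
def ToothCardSmallAtThree : Prop :=
  ∀ (W : WeierstrassCurve ℚ) [W.IsElliptic] [W.IsGloballyMinimal] (N : ℕ) [NeZero N] (K : Type) [Field K]
    [NumberField K] (Dt : Literature.NumberTheory.EllipticCurves.ModularForms.ModularParametrizationData W N),
    Summit.BirchSwinnertonDyer.Rank1Residual.Additive.ClassO6 W 3 → W.HasSurjectiveModNGaloisRep 3 →
    W.analyticRank = 1 → W.conductorNorm ℤ = N → Literature.NumberTheory.EllipticCurves.IsImaginaryQuadratic K →
    Literature.NumberTheory.EllipticCurves.SatisfiesHeegnerHypothesis N K →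
    ∀ (κ : Literature.NumberTheory.EllipticCurves.ZpExtension K 3), κ.IsAnticyclotomic →
    ∀ (γ : Field.absoluteGaloisGroup K) [Fact (κ.IsTopGenerator γ)]
      (𝔭 : IsDedekindDomain.HeightOneSpectrum (NumberField.RingOfIntegers K)),
      ((3 : ℕ) : NumberField.RingOfIntegers K) ∈ 𝔭.asIdeal →
      𝔭.asIdeal.ramificationIdx (NumberField.RingOfIntegers ℚ) = 1 →
      𝔭.asIdeal.inertiaDeg (NumberField.RingOfIntegers ℚ) = 1 →
    ∀ (𝔭' : IsDedekindDomain.HeightOneSpectrum (NumberField.RingOfIntegers K)),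
      ((3 : ℕ) : NumberField.RingOfIntegers K) ∈ 𝔭'.asIdeal → 𝔭' ≠ 𝔭 →
    ∀ k₀ : ℕ, ∃ k : ℕ, k₀ ≤ k ∧ Finite (ToothQuot (AcSelmer.XAc (W.baseChange K) 3 κ 𝔭' ∅ γ) k) ∧
      Nat.card (ToothQuot (AcSelmer.XAc (W.baseChange K) 3 κ 𝔭' ∅ γ) k) ^ 2 ≤ 3 ^ Nat.totient (3 ^ k)

/-! ## Registered stubs (the pieces as `sorry`s; nothing else in this file is sorried) -/

/-- STUB (WEAKER — route item 24207 `RationalSplitIMCInclusionAtThree` BY NAME; implied by the wall with `k = 0`,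
live LEAD cruxlead-24207). -/
theorem stub_ratwall : RationalSplitIMCInclusionAtThree := by
  sorry

/-- STUB (UNDECIDED — piece B; proved from the teeth by `selfAlgMuZeroAtThree_of_teeth` below modulo c1–c3, or
from the twin by the kernel road 24737 → GV 2.8). -/
theorem stub_selfAlgMuZero : SelfAlgMuZeroAtThree := by
  sorry

/-- STUB (ATTACKABLE — piece c1, pure algebra). -/
theorem stub_isTorsionOfFiniteToothQuot : IsTorsionOfFiniteToothQuot := by
  sorry

/-- STUB (ATTACKABLE — piece c2, pure algebra). -/
theorem stub_toothReadsMu : ToothReadsMu := by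
  sorry

/-- STUB (UNDECIDED — piece c3, the arithmetic leaf). -/
theorem stub_toothCardSmall : ToothCardSmallAtThree := by
  sorry

/-! ## TOP composition: RATWALL + self-`μ = 0` ⟹ THE WALL (3-saturation in `R₀⟦T⟧`) -/

/-- **The wall from the rational wall and the curve's own `μ = 0`.** If `3^k·L ∈ Ch·R₀⟦T⟧ = (g′)` and `g′` has a
coefficient of norm `1`, then `3 ∤ g′` in the domain `R₀⟦T⟧` where `3` is prime, so `g′ ∣ 3^k L` forces `g′ ∣ L`,
i.e. `(L) ⊆ (g′)`. Concludes the crux `AdditiveSplitIMCInclusionAtThree` BY NAME. [folklore; Washington1997 §7.1] -/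
theorem AdditiveSplitIMCInclusionAtThree_of :
    RationalSplitIMCInclusionAtThree → SelfAlgMuZeroAtThree → AdditiveSplitIMCInclusionAtThree := by
  intro hR hM W _ _ N _ K _ _ Dt hO6 hsurj hr1 hN hK hH κ hκ γ _ 𝔭 h3 he hf 𝔭' h3' hne ι' hι ΩK Ωp L hΩK hΩp hL
  obtain ⟨k, hk⟩ := hR W N K Dt hO6 hsurj hr1 hN hK hH κ hκ γ 𝔭 h3 he hf 𝔭' h3' hne ι' hι ΩK Ωp L hΩK hΩp hL
  obtain ⟨-, g, hg, i, hi⟩ := hM W N K Dt hO6 hsurj hr1 hN hK hH κ hκ γ 𝔭 h3 he hf 𝔭' h3' hne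
  rw [hg] at hk ⊢
  have hdvd : g ∣ ((3 : ℕ) : UnrSeries 3) ^ k * L := Ideal.mem_span_singleton.mp hk
  rw [← map_natCast (PowerSeries.C (R := unrIntegers 3))] at hdvd
  exact Ideal.span_singleton_le_span_singleton.mpr
    (dvd_of_dvd_prime_pow_mul prime_C_three (not_C_three_dvd_of_norm_coeff_eq_one hi) k hdvd)

/-! ## CHILD composition: the teeth give piece B -/

/-- **Self-`μ = 0` from the teeth.** `X = X_(∅,0)(E/K_∞)` is finitely generated over `Λ` (LANDED,
`AcSelmer.XAc.module_finite`); one finite tooth specialisation makes it torsion (c1); small tooth specialisations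
infinitely often make `μ(X) = 0` (c2 fed by c3); and `μ = 0` for a finitely generated torsion `X` is exactly the
route's `R₀⟦T⟧` currency (LANDED, `UniversalToricDescentAcDualMuZero.exists_map_charIdeal_eq_span_of_muInvariant_eq_zero`).
[GreenbergVatsal2000 §2 Prop. 2.8; Washington1997 §13.2] -/
theorem selfAlgMuZeroAtThree_of_teeth :
    IsTorsionOfFiniteToothQuot → ToothReadsMu → ToothCardSmallAtThree → SelfAlgMuZeroAtThree := by
  intro h1 h2 h3 W _ _ N _ K _ _ Dt hO6 hsurj hr1 hN hK hH κ hκ γ _ 𝔭 hp3 he hf 𝔭' h3' hne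
  haveI : Module.Finite (IwasawaAlgebra 3) (AcSelmer.XAc (W.baseChange K) 3 κ 𝔭' ∅ γ) :=
    AcSelmer.XAc.module_finite κ 𝔭' ∅ γ Set.finite_empty (W := W.baseChange K)
  have hsmall := h3 W N K Dt hO6 hsurj hr1 hN hK hH κ hκ γ 𝔭 hp3 he hf 𝔭' h3' hne
  obtain ⟨k, -, hfin, -⟩ := hsmall 0
  have hT : Module.IsTorsion (IwasawaAlgebra 3) (AcSelmer.XAc (W.baseChange K) 3 κ 𝔭' ∅ γ) :=
    h1 (AcSelmer.XAc (W.baseChange K) 3 κ 𝔭' ∅ γ) ⟨k, hfin⟩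
  have hμ : muInvariant 3 (AcSelmer.XAc (W.baseChange K) 3 κ 𝔭' ∅ γ) = 0 :=
    h2 (AcSelmer.XAc (W.baseChange K) 3 κ 𝔭' ∅ γ) hT hsmall
  exact ⟨hT, Summit.BirchSwinnertonDyer.BirchSwinnertonDyer.Theorems.UniversalToricDescentAcDualMuZero.exists_map_charIdeal_eq_span_of_muInvariant_eq_zero
    (AcSelmer.XAc (W.baseChange K) 3 κ 𝔭' ∅ γ) hT hμ⟩

/-- The two levels chained: the wall from RATWALL and the three tooth pieces. -/
theorem AdditiveSplitIMCInclusionAtThree_of_teeth :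
    RationalSplitIMCInclusionAtThree → IsTorsionOfFiniteToothQuot → ToothReadsMu → ToothCardSmallAtThree →
      AdditiveSplitIMCInclusionAtThree :=
  fun hR h1 h2 h3 ↦ AdditiveSplitIMCInclusionAtThree_of hR (selfAlgMuZeroAtThree_of_teeth h1 h2 h3)

end Summit.BirchSwinnertonDyer.BirchSwinnertonDyer.Cruxes.AdditiveSplitIMCInclusionAtThree.ToothwiseKolyvaginMu

end
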